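import Literature.NumberTheory.Sieve.DrappeauDispersionS1Phase
import HarnessLib

/-!
# Drappeau 2017, §5.5: the pieces `ℛ₁(q₀,n₀)` in the variables `q_j = q₀q_j'`, `n_j = n₀n_j'`

Topic `Literature/NumberTheory/Sieve`, part of the formalisation of §5 of S. Drappeau, Proc. London
Math. Soc. (3) 114 (2017) 684–732 = arXiv:1504.05549 (Theorem 5.1 = the named fact
`Literature.NumberTheory.Sieve.Drappeau2017_theorem51`).  Everything here is PROVED; no definition
and no named fact is introduced.

§5.5 (arXiv p. 20) opens with "Let us rename `q₁` into `q₀q₁` and `q₂` into `q₀q₂`, and similarly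
for `n₁` and `n₂`": the piece of `𝒮₁`/`ℛ₁` with `(q₁,q₂) = q₀`, `(n₁,n₂) = n₀` (the weights
`1_{(q₁,q₂)=q₀,(n₁,n₂)=n₀}` of `DrappeauDispersionS1PoissonWeighted` /
`Drappeau2017_theorem51_of_R1small`) becomes a sum over `q_j'`, `n_j'` with `(q₁',q₂') = (n₁',n₂') = 1`.
This file provides that re-indexing in a form directly applicable to the tree's pieces:

* `Drappeau2017.sum_eq_sum_image_div` — `∑_{q ∈ A} F(q) = ∑_{q' ∈ A/q₀} F(q₀q')` when `F`
  vanishes off the multiples of `q₀`;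
* `Drappeau2017.sum_gcd_weight_reindex` — the four-fold version for summands
  `1_{(q₁,q₂)=q₀,(n₁,n₂)=n₀} P(n₁,n₂) G(q₁,q₂,n₁,n₂)`;
* `Drappeau2017.R1piece_eq_reindex` — applied to the piece `ℛ₁^{wt,≤H}(q₀,n₀)` of
  `Drappeau2017_theorem51_of_R1small` (its `b`-sum is then the one of
  `Drappeau2017.bsum_fourierChar_eq`, `DrappeauDispersionS1Phase`).

## References

* S. Drappeau, Proc. London Math. Soc. (3) 114 (2017) 684–732, arXiv:1504.05549, §5.5.
  [cite: Drappeau2017, §5.5]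
-/

noncomputable section

open Finset
open scoped FourierTransform

namespace Literature.NumberTheory.Sieve

namespace Drappeau2017

/-- `q' ∈ {q ∈ A : q₀ ∣ q}/q₀ ↔ q₀q' ∈ A` (`q₀ ≥ 1`). [folklore] -/
theorem mem_image_div_iff {A : Finset ℕ} {q₀ : ℕ} (hq₀ : 0 < q₀) {q' : ℕ} :
    q' ∈ (A.filter (fun q : ℕ => q₀ ∣ q)).image (fun q : ℕ => q / q₀) ↔ q₀ * q' ∈ A := by
  rw [Finset.mem_image]
  constructor
  · rintro ⟨q, hq, rfl⟩
    rw [Finset.mem_filter] at hq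
    rw [Nat.mul_div_cancel' hq.2]; exact hq.1
  · intro h
    exact ⟨q₀ * q', Finset.mem_filter.2 ⟨h, Dvd.intro q' rfl⟩, by rw [Nat.mul_div_cancel_left _ hq₀]⟩

/-- **Re-indexing over multiples**: if `F` vanishes at the `q ∈ A` not divisible by `q₀ ≥ 1`, then
`∑_{q ∈ A} F(q) = ∑_{q' ∈ {q ∈ A : q₀ ∣ q}/q₀} F(q₀q')`. [folklore] -/
theorem sum_eq_sum_image_div {A : Finset ℕ} {q₀ : ℕ} (F : ℕ → ℂ)
    (hF : ∀ q ∈ A, ¬ q₀ ∣ q → F q = 0) :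
    ∑ q ∈ A, F q = ∑ q' ∈ (A.filter (fun q : ℕ => q₀ ∣ q)).image (fun q : ℕ => q / q₀), F (q₀ * q') := by
  have h1 : ∑ q ∈ A, F q = ∑ q ∈ A.filter (fun q : ℕ => q₀ ∣ q), F q := by
    rw [Finset.sum_filter]
    refine Finset.sum_congr rfl fun q hq => ?_
    by_cases h : q₀ ∣ q
    · rw [if_pos h]
    · rw [if_neg h, hF q hq h]
  rw [h1, Finset.sum_image]
  · refine Finset.sum_congr rfl fun q hq => ?_
    rw [Nat.mul_div_cancel' (Finset.mem_filter.1 hq).2]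
  · intro q₁ hq₁ q₂ hq₂ h
    have h₁ := Nat.mul_div_cancel' (Finset.mem_filter.1 (Finset.mem_coe.1 hq₁)).2
    have h₂ := Nat.mul_div_cancel' (Finset.mem_filter.1 (Finset.mem_coe.1 hq₂)).2
    simp only at h
    rw [← h₁, ← h₂, h]

/-- `(q₀a, q₀b) = q₀ ↔ (a,b) = 1` for `q₀ ≥ 1`. [folklore] -/
theorem gcd_mul_eq_iff {q₀ a b : ℕ} (hq₀ : 0 < q₀) : Nat.gcd (q₀ * a) (q₀ * b) = q₀ ↔ Nat.Coprime a b := by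
  rw [Nat.gcd_mul_left, Nat.Coprime]
  constructor
  · intro h; exact Nat.eq_of_mul_eq_mul_left hq₀ (h.trans (mul_one q₀).symm)
  · intro h; rw [h, mul_one]

/-- **Drappeau 2017, §5.5: the piece `(q₁,q₂) = q₀`, `(n₁,n₂) = n₀` in the variables `q₀q_j'`,
`n₀n_j'`.**  For `q₀, n₀ ≥ 1` and any `c`, `P`, `G`:
`∑_{q₁,q₂∈A} c(q₁,q₂) ∑_{n₁,n₂∈B} 1_{(q₁,q₂)=q₀,(n₁,n₂)=n₀} P(n₁,n₂) G(q₁,q₂,n₁,n₂)`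
`= ∑_{q₁',q₂'∈A/q₀} c(q₀q₁',q₀q₂') ∑_{n₁',n₂'∈B/n₀} 1_{(q₁',q₂')=(n₁',n₂')=1} P(n₀n₁',n₀n₂') G(q₀q₁',q₀q₂',n₀n₁',n₀n₂')`
("let us rename `q_j` into `q₀q_j` … and similarly for `n_j`"). [cite: Drappeau2017, §5.5] -/
theorem sum_gcd_weight_reindex (A B : Finset ℕ) {q₀ n₀ : ℕ} (hq₀ : 0 < q₀) (hn₀ : 0 < n₀)
    (c : ℕ → ℕ → ℂ) (P : ℕ → ℕ → ℂ) (G : ℕ → ℕ → ℕ → ℕ → ℂ) :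
    ∑ q₁ ∈ A, ∑ q₂ ∈ A, c q₁ q₂ * ∑ n₁ ∈ B, ∑ n₂ ∈ B,
        (if (Nat.gcd q₁ q₂ = q₀ ∧ Nat.gcd n₁ n₂ = n₀) then (1 : ℂ) else 0) * P n₁ n₂ *
          G q₁ q₂ n₁ n₂ =
      ∑ q₁' ∈ (A.filter (fun q : ℕ => q₀ ∣ q)).image (fun q : ℕ => q / q₀),
        ∑ q₂' ∈ (A.filter (fun q : ℕ => q₀ ∣ q)).image (fun q : ℕ => q / q₀),
          c (q₀ * q₁') (q₀ * q₂') *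
            ∑ n₁' ∈ (B.filter (fun n : ℕ => n₀ ∣ n)).image (fun n : ℕ => n / n₀),
              ∑ n₂' ∈ (B.filter (fun n : ℕ => n₀ ∣ n)).image (fun n : ℕ => n / n₀),
                (if (Nat.Coprime q₁' q₂' ∧ Nat.Coprime n₁' n₂') then (1 : ℂ) else 0) *
                  P (n₀ * n₁') (n₀ * n₂') * G (q₀ * q₁') (q₀ * q₂') (n₀ * n₁') (n₀ * n₂') := by
  -- vanishing off the multiples
  have hwt : ∀ q₁ q₂ n₁ n₂ : ℕ, (¬ q₀ ∣ q₁ ∨ ¬ q₀ ∣ q₂ ∨ ¬ n₀ ∣ n₁ ∨ ¬ n₀ ∣ n₂) →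
      (if (Nat.gcd q₁ q₂ = q₀ ∧ Nat.gcd n₁ n₂ = n₀) then (1 : ℂ) else 0) = 0 := by
    intro q₁ q₂ n₁ n₂ h
    rw [if_neg]
    rintro ⟨hq, hn⟩
    rcases h with h | h | h | h
    · exact h (hq ▸ Nat.gcd_dvd_left q₁ q₂)
    · exact h (hq ▸ Nat.gcd_dvd_right q₁ q₂)
    · exact h (hn ▸ Nat.gcd_dvd_left n₁ n₂)
    · exact h (hn ▸ Nat.gcd_dvd_right n₁ n₂)
  -- `q₁`
  rw [sum_eq_sum_image_div _ (fun q₁ _ h => Finset.sum_eq_zero fun q₂ _ => by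
    rw [mul_eq_zero]; right
    exact Finset.sum_eq_zero fun n₁ _ => Finset.sum_eq_zero fun n₂ _ => by
      rw [hwt q₁ q₂ n₁ n₂ (Or.inl h), zero_mul, zero_mul])]
  refine Finset.sum_congr rfl fun q₁' _ => ?_
  -- `q₂`
  rw [sum_eq_sum_image_div _ (fun q₂ _ h => by
    rw [mul_eq_zero]; right
    exact Finset.sum_eq_zero fun n₁ _ => Finset.sum_eq_zero fun n₂ _ => by
      rw [hwt _ q₂ n₁ n₂ (Or.inr (Or.inl h)), zero_mul, zero_mul])]
  refine Finset.sum_congr rfl fun q₂' _ => ?_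
  congr 1
  -- `n₁`
  rw [sum_eq_sum_image_div _ (fun n₁ _ h => Finset.sum_eq_zero fun n₂ _ => by
    rw [hwt _ _ n₁ n₂ (Or.inr (Or.inr (Or.inl h))), zero_mul, zero_mul])]
  refine Finset.sum_congr rfl fun n₁' _ => ?_
  -- `n₂`
  rw [sum_eq_sum_image_div _ (fun n₂ _ h => by
    rw [hwt _ _ _ n₂ (Or.inr (Or.inr (Or.inr h))), zero_mul, zero_mul])]
  refine Finset.sum_congr rfl fun n₂' _ => ?_
  have e : (Nat.gcd (q₀ * q₁') (q₀ * q₂') = q₀ ∧ Nat.gcd (n₀ * n₁') (n₀ * n₂') = n₀) ↔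
      (Nat.Coprime q₁' q₂' ∧ Nat.Coprime n₁' n₂') := by
    rw [gcd_mul_eq_iff hq₀, gcd_mul_eq_iff hn₀]
  simp only [e]

/-- **The piece `ℛ₁^{wt,≤H}(q₀,n₀)` of the truncated frequency sum in the variables `q₀q_j'`,
`n₀n_j'`** (the hypothesis of `Drappeau2017_theorem51_of_R1small`, re-indexed as at the start of
§5.5). [cite: Drappeau2017, §5.5] -/
theorem R1piece_eq_reindex (a₁ a₂ : ℤ) (𝒬 𝒩 : Finset ℕ) (γ : ℕ → ℝ) (β : ℕ → ℂ) (M : ℝ)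
    (H : ℕ) {q₀ n₀ : ℕ} (hq₀ : 0 < q₀) (hn₀ : 0 < n₀) :
    ∑ q₁ ∈ 𝒬, ∑ q₂ ∈ 𝒬, (γ q₁ : ℂ) * (γ q₂ : ℂ) *
        ∑ n₁ ∈ 𝒩, ∑ n₂ ∈ 𝒩,
          (if (Nat.gcd q₁ q₂ = q₀ ∧ Nat.gcd n₁ n₂ = n₀) then (1 : ℂ) else 0) *
            (β n₁ * starRingEnd ℂ (β n₂)) *
          ((M : ℂ) / (Nat.lcm q₁ q₂ : ℂ) *
            ∑ b ∈ (Finset.range (Nat.lcm q₁ q₂)).filter (fun b : ℕ =>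
                (b : ZMod q₁) * ((n₁ : ZMod q₁) * (a₂ : ZMod q₁)) = (a₁ : ZMod q₁) ∧
                (b : ZMod q₂) * ((n₂ : ZMod q₂) * (a₂ : ZMod q₂)) = (a₁ : ZMod q₂)),
              ∑ h ∈ Finset.Icc (-(H : ℤ)) H, (if ((Nat.lcm q₁ q₂ : ℕ) : ℤ) ∣ h then 0 else
                𝓕 (BFI.bumpC 1 (1 / 2)) (M * h / (Nat.lcm q₁ q₂ : ℕ)) *
                  (𝐞 ((b : ℝ) * h / (Nat.lcm q₁ q₂ : ℕ)) : ℂ))) =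
      ∑ q₁' ∈ (𝒬.filter (fun q : ℕ => q₀ ∣ q)).image (fun q : ℕ => q / q₀),
        ∑ q₂' ∈ (𝒬.filter (fun q : ℕ => q₀ ∣ q)).image (fun q : ℕ => q / q₀),
          (γ (q₀ * q₁') : ℂ) * (γ (q₀ * q₂') : ℂ) *
            ∑ n₁' ∈ (𝒩.filter (fun n : ℕ => n₀ ∣ n)).image (fun n : ℕ => n / n₀),
              ∑ n₂' ∈ (𝒩.filter (fun n : ℕ => n₀ ∣ n)).image (fun n : ℕ => n / n₀),
                (if (Nat.Coprime q₁' q₂' ∧ Nat.Coprime n₁' n₂') then (1 : ℂ) else 0) *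
                  (β (n₀ * n₁') * starRingEnd ℂ (β (n₀ * n₂'))) *
                ((M : ℂ) / (Nat.lcm (q₀ * q₁') (q₀ * q₂') : ℂ) *
                  ∑ b ∈ (Finset.range (Nat.lcm (q₀ * q₁') (q₀ * q₂'))).filter (fun b : ℕ =>
                      (b : ZMod (q₀ * q₁')) * ((((n₀ * n₁' : ℕ)) : ZMod (q₀ * q₁')) *
                        (a₂ : ZMod (q₀ * q₁'))) = (a₁ : ZMod (q₀ * q₁')) ∧
                      (b : ZMod (q₀ * q₂')) * ((((n₀ * n₂' : ℕ)) : ZMod (q₀ * q₂')) *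
                        (a₂ : ZMod (q₀ * q₂'))) = (a₁ : ZMod (q₀ * q₂'))),
                    ∑ h ∈ Finset.Icc (-(H : ℤ)) H,
                      (if ((Nat.lcm (q₀ * q₁') (q₀ * q₂') : ℕ) : ℤ) ∣ h then 0 else
                        𝓕 (BFI.bumpC 1 (1 / 2)) (M * h / (Nat.lcm (q₀ * q₁') (q₀ * q₂') : ℕ)) *
                          (𝐞 ((b : ℝ) * h / (Nat.lcm (q₀ * q₁') (q₀ * q₂') : ℕ)) : ℂ))) := by
  have h := sum_gcd_weight_reindex 𝒬 𝒩 hq₀ hn₀ (fun q₁ q₂ => (γ q₁ : ℂ) * (γ q₂ : ℂ))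
    (fun n₁ n₂ => β n₁ * starRingEnd ℂ (β n₂))
    (fun q₁ q₂ n₁ n₂ => (M : ℂ) / (Nat.lcm q₁ q₂ : ℂ) *
      ∑ b ∈ (Finset.range (Nat.lcm q₁ q₂)).filter (fun b : ℕ =>
          (b : ZMod q₁) * ((n₁ : ZMod q₁) * (a₂ : ZMod q₁)) = (a₁ : ZMod q₁) ∧
          (b : ZMod q₂) * ((n₂ : ZMod q₂) * (a₂ : ZMod q₂)) = (a₁ : ZMod q₂)),
        ∑ h ∈ Finset.Icc (-(H : ℤ)) H, (if ((Nat.lcm q₁ q₂ : ℕ) : ℤ) ∣ h then 0 else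
          𝓕 (BFI.bumpC 1 (1 / 2)) (M * h / (Nat.lcm q₁ q₂ : ℕ)) *
            (𝐞 ((b : ℝ) * h / (Nat.lcm q₁ q₂ : ℕ)) : ℂ)))
  beta_reduce at h
  simpa only [Nat.cast_mul] using h

end Drappeau2017

end Literature.NumberTheory.Sieve

end
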